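import Mathlib.Data.Finset.Card
import Mathlib.Order.Disjoint
import HarnessLib

/-!
# `NoHeavyLowerTail` (stmt-CriticalPhenomena-4575) — the combinatorial core of TROPICAL `C₃` (Kahn's conjecture at leading order as `q → 0`)

Support file, seat `prim-l12-p5` (gen 2), `--supports stmt-CriticalPhenomena-4575`.  No definitions, no named facts, no sorries.

CONTEXT (P5-REPORT §3h(m), proved by hand, all `k`).  For non-zero monotone Boolean `f₁,f₂,f₃` on `{0,1}^k` and weights `q_i = ε·w_i`,
Sahi's `E₃(f₁,f₂,f₃) = L·ε^D + O(ε^{D+1})`, `D` = the minimum size of a set in `F := f₁ ∩ f₂ ∩ f₃` (sets = supports of points), and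
`L = Σ_{u ∈ F, |u| = D} w^u·(2 − n(u) + t(u))`, where `n(u)` counts the indices `a` (with `d_a + d_bc = D`) for which `u = g ⊔ h` splits
into a minimum-size element `g` of `f_a` and a (minimum-size) element `h` of `f_b ∩ f_c`, and `t(u) = 1` iff `u` is a disjoint union of
minimum-size elements of the three functions (and `d₁+d₂+d₃ = D`).  `L ≥ 0` termwise because `n(u) = 3` forces `t(u) = 1`; that implication is
the content of the two lemmas below, stated for arbitrary upward-closed predicates on `Finset α`:

* `tropical_exchange` — if a minimum-cardinality member `u` of `P₁ ∧ P₂ ∧ P₃` splits as `u = g₁ ⊔ h₁ = g₂ ⊔ h₂` with `h₁` satisfying `P₂, P₃`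
  and `h₂` satisfying `P₁`, then `g₁` and `g₂` are disjoint (the exchange argument: `h₁ ∪ h₂` satisfies all three predicates inside `u`,
  so equals `u` by minimality, whence `g₂ ⊆ h₁`);
* `tropical_three_splits` — three such splits (one per index) force `u = g₁ ∪ g₂ ∪ g₃` with the `g`'s pairwise disjoint.
* `tropical_pair_splits_unique` — the companion lemma for the `q → 1` corner (P5-REPORT §3h(m′)): when all pairwise minima equal `D`, a
  minimum member `u` cannot split as `γ₁ ⊔ γ₂` and as `γ₁' ⊔ γ₃` with `|γ₃| < D`.
-/

namespace Summit.CriticalPhenomena.PercolationContinuityZ3.Theorems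

namespace SahiTropical

variable {α : Type*} [DecidableEq α]

/-- **Exchange lemma.**  `P₁,P₂,P₃` upward-closed predicates on finite sets; `u` satisfies all three and has minimum cardinality among such
sets; `u = g₁ ∪ h₁ = g₂ ∪ h₂` with `g₁ ∩ h₁ = ∅ = g₂ ∩ h₂`, `h₁` satisfying `P₂` and `P₃`, `h₂` satisfying `P₁`.  Then `g₁ ∩ g₂ = ∅`.
[this file] -/
theorem tropical_exchange (P₁ P₂ P₃ : Finset α → Prop)
    (hP₁ : ∀ s t, s ⊆ t → P₁ s → P₁ t) (hP₂ : ∀ s t, s ⊆ t → P₂ s → P₂ t) (hP₃ : ∀ s t, s ⊆ t → P₃ s → P₃ t)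
    {u g₁ h₁ g₂ h₂ : Finset α}
    (hmin : ∀ v, P₁ v → P₂ v → P₃ v → u.card ≤ v.card)
    (hu₁ : g₁ ∪ h₁ = u) (hd₁ : Disjoint g₁ h₁) (hu₂ : g₂ ∪ h₂ = u) (hd₂ : Disjoint g₂ h₂)
    (h₁P₂ : P₂ h₁) (h₁P₃ : P₃ h₁) (h₂P₁ : P₁ h₂) :
    Disjoint g₁ g₂ := by
  -- `h₁ ∪ h₂` satisfies all three predicates and sits inside `u`
  have hsub : h₁ ∪ h₂ ⊆ u := by
    rw [← hu₁]
    intro x hx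
    rcases Finset.mem_union.mp hx with hx | hx
    · exact Finset.mem_union.mpr (Or.inr hx)
    · have : x ∈ u := by rw [← hu₂]; exact Finset.mem_union.mpr (Or.inr hx)
      rw [← hu₁] at this; exact this
  have hall₁ : P₁ (h₁ ∪ h₂) := hP₁ h₂ _ Finset.subset_union_right h₂P₁
  have hall₂ : P₂ (h₁ ∪ h₂) := hP₂ h₁ _ Finset.subset_union_left h₁P₂
  have hall₃ : P₃ (h₁ ∪ h₂) := hP₃ h₁ _ Finset.subset_union_left h₁P₃
  have hcard : u.card ≤ (h₁ ∪ h₂).card := hmin _ hall₁ hall₂ hall₃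
  have heq : h₁ ∪ h₂ = u := Finset.eq_of_subset_of_card_le hsub hcard
  -- hence `g₂ ⊆ h₁`
  have hg₂ : g₂ ⊆ h₁ := by
    intro x hx
    have hxu : x ∈ u := by rw [← hu₂]; exact Finset.mem_union.mpr (Or.inl hx)
    rw [← heq] at hxu
    rcases Finset.mem_union.mp hxu with h | h
    · exact h
    · exact absurd h (Finset.disjoint_left.mp hd₂ hx)
  exact Finset.disjoint_of_subset_right hg₂ hd₁

/-- **Three splits force the disjoint-generator shape.**  If a minimum-cardinality member `u` of `P₁ ∧ P₂ ∧ P₃` splits as `u = g_a ⊔ h_a` for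
EACH `a ∈ {1,2,3}` with `g_a` satisfying `P_a` and `h_a` satisfying the other two predicates, then the `g_a` are pairwise disjoint and
`u = g₁ ∪ g₂ ∪ g₃` (this is `n(u) = 3 ⇒ t(u) = 1` in the tropical coefficient). [this file] -/
theorem tropical_three_splits (P₁ P₂ P₃ : Finset α → Prop)
    (hP₁ : ∀ s t, s ⊆ t → P₁ s → P₁ t) (hP₂ : ∀ s t, s ⊆ t → P₂ s → P₂ t) (hP₃ : ∀ s t, s ⊆ t → P₃ s → P₃ t)
    {u g₁ h₁ g₂ h₂ g₃ h₃ : Finset α}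
    (hmin : ∀ v, P₁ v → P₂ v → P₃ v → u.card ≤ v.card)
    (hu₁ : g₁ ∪ h₁ = u) (hd₁ : Disjoint g₁ h₁) (hg₁ : P₁ g₁) (h₁P₂ : P₂ h₁) (h₁P₃ : P₃ h₁)
    (hu₂ : g₂ ∪ h₂ = u) (hd₂ : Disjoint g₂ h₂) (hg₂ : P₂ g₂) (h₂P₁ : P₁ h₂) (h₂P₃ : P₃ h₂)
    (hu₃ : g₃ ∪ h₃ = u) (hd₃ : Disjoint g₃ h₃) (hg₃ : P₃ g₃) (h₃P₁ : P₁ h₃) (h₃P₂ : P₂ h₃) :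
    Disjoint g₁ g₂ ∧ Disjoint g₁ g₃ ∧ Disjoint g₂ g₃ ∧ g₁ ∪ g₂ ∪ g₃ = u := by
  have d12 : Disjoint g₁ g₂ := tropical_exchange P₁ P₂ P₃ hP₁ hP₂ hP₃ hmin hu₁ hd₁ hu₂ hd₂ h₁P₂ h₁P₃ h₂P₁
  have d13 : Disjoint g₁ g₃ := by
    -- apply the exchange lemma with the roles of the predicates `P₂` and `P₃` swapped
    exact tropical_exchange P₁ P₃ P₂ hP₁ hP₃ hP₂ (fun v a b c => hmin v a c b) hu₁ hd₁ hu₃ hd₃ h₁P₃ h₁P₂ h₃P₁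
  have d23 : Disjoint g₂ g₃ := by
    exact tropical_exchange P₂ P₃ P₁ hP₂ hP₃ hP₁ (fun v a b c => hmin v c a b) hu₂ hd₂ hu₃ hd₃ h₂P₃ h₂P₁ h₃P₂
  refine ⟨d12, d13, d23, ?_⟩
  have hsub : g₁ ∪ g₂ ∪ g₃ ⊆ u := by
    intro x hx
    rcases Finset.mem_union.mp hx with hx | hx
    · rcases Finset.mem_union.mp hx with hx | hx
      · rw [← hu₁]; exact Finset.mem_union.mpr (Or.inl hx)
      · rw [← hu₂]; exact Finset.mem_union.mpr (Or.inl hx)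
    · rw [← hu₃]; exact Finset.mem_union.mpr (Or.inl hx)
  have hall₁ : P₁ (g₁ ∪ g₂ ∪ g₃) :=
    hP₁ g₁ _ (Finset.subset_union_left.trans Finset.subset_union_left) hg₁
  have hall₂ : P₂ (g₁ ∪ g₂ ∪ g₃) :=
    hP₂ g₂ _ (Finset.subset_union_right.trans Finset.subset_union_left) hg₂
  have hall₃ : P₃ (g₁ ∪ g₂ ∪ g₃) := hP₃ g₃ _ Finset.subset_union_right hg₃
  exact Finset.eq_of_subset_of_card_le hsub (hmin _ hall₁ hall₂ hall₃)

/-- **The `q → 1` corner (sparse complements): at most one pairwise split.**  `P₁,P₂,P₃` upward-closed; `u` satisfies all three with minimum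
cardinality `D`; every member of `P₁ ∧ P₃` and every member of `P₂ ∧ P₃` has cardinality `≥ D` (the "all pairs tight" case `d₁₃ = d₂₃ = D` of
P5-REPORT §3h(m′)).  If `u = γ₁ ⊔ γ₂ = γ₁' ⊔ γ₃` with `γ₁, γ₁'` satisfying `P₁`, `γ₂` satisfying `P₂`, `γ₃` satisfying `P₃`, and `γ₃.card < D`, then
`False`: `γ₂ ∪ γ₃` satisfies `P₂ ∧ P₃` inside `u`, so equals `u`; hence `γ₁ ⊆ γ₃`, so `γ₃` satisfies `P₁ ∧ P₃` with fewer than `D` elements.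
This is the lemma `Σ_bc s_bc(u) ≤ 1` making the leading `ε`-coefficient of `E₃` at `q → 1` termwise nonnegative. [this file] -/
theorem tropical_pair_splits_unique (P₁ P₂ P₃ : Finset α → Prop)
    (hP₁ : ∀ s t, s ⊆ t → P₁ s → P₁ t) (hP₂ : ∀ s t, s ⊆ t → P₂ s → P₂ t) (hP₃ : ∀ s t, s ⊆ t → P₃ s → P₃ t)
    {u γ₁ γ₂ γ₁' γ₃ : Finset α} {D : ℕ} (huD : u.card = D)
    (h13 : ∀ v, P₁ v → P₃ v → D ≤ v.card) (h23 : ∀ v, P₂ v → P₃ v → D ≤ v.card)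
    (hu₁ : γ₁ ∪ γ₂ = u) (hd₁ : Disjoint γ₁ γ₂) (hu₂ : γ₁' ∪ γ₃ = u)
    (hγ₁ : P₁ γ₁) (hγ₂ : P₂ γ₂) (hγ₃ : P₃ γ₃) (hsmall : γ₃.card < D) : False := by
  have hsub : γ₂ ∪ γ₃ ⊆ u := by
    intro x hx
    rcases Finset.mem_union.mp hx with hx | hx
    · rw [← hu₁]; exact Finset.mem_union.mpr (Or.inr hx)
    · rw [← hu₂]; exact Finset.mem_union.mpr (Or.inr hx)
  have h2 : P₂ (γ₂ ∪ γ₃) := hP₂ γ₂ _ Finset.subset_union_left hγ₂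
  have h3 : P₃ (γ₂ ∪ γ₃) := hP₃ γ₃ _ Finset.subset_union_right hγ₃
  have hcard : u.card ≤ (γ₂ ∪ γ₃).card := huD ▸ h23 _ h2 h3
  have heq : γ₂ ∪ γ₃ = u := Finset.eq_of_subset_of_card_le hsub hcard
  have hγ₁₃ : γ₁ ⊆ γ₃ := by
    intro x hx
    have hxu : x ∈ u := by rw [← hu₁]; exact Finset.mem_union.mpr (Or.inl hx)
    rw [← heq] at hxu
    rcases Finset.mem_union.mp hxu with h | h
    · exact absurd h (Finset.disjoint_left.mp hd₁ hx)
    · exact h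
  have hP₁γ₃ : P₁ γ₃ := hP₁ γ₁ _ hγ₁₃ hγ₁
  exact absurd (h13 _ hP₁γ₃ hγ₃) (not_le.mpr hsmall)

end SahiTropical

end Summit.CriticalPhenomena.PercolationContinuityZ3.Theorems
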